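import Literature.RingTheory.LocalCohomology.CechComplex
import HarnessLib

/-!
# Čech cohomology classes are `y_j`-power torsion

Topic `Literature/RingTheory/LocalCohomology`, sequel of `CechComplex.lean`. For the extended Čech
complex `0 → M → ∏ M_{y_i} → ∏ M_{y_i y_j} → ⋯` of a module `M` with respect to `y_1, …, y_s`
(full ordered version), every cohomology class is killed by a power of each `y_j` — Eisenbud,
*The Geometry of Syzygies*, Cor. A1.2 ("Any element of `H^i_Q(M)` is annihilated by some power of
`Q`"), here proved directly on cocycles by contracting the complex towards the index `j`
(the standard null-homotopy of the Čech complex of a module on which `y_j` is invertible, with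
denominators cleared):

* `exists_pow_smul_eq_zero_of_cechAug_eq_zero` — degree `0`: `ε(m) = 0 ⇒ y_j^N m = 0`;
* `exists_pow_smul_eq_cechAug` — degree `1`: a cocycle `c ∈ Č^0` has `y_j^N c ∈ ε(M)`;
* `exists_pow_smul_eq_dC` — degrees `≥ 2`: a cocycle `c ∈ Č^{q+1}` has `y_j^N c ∈ d(Č^q)`;

with the formulas in the localisations they rest on (`exists_pow_smul_eq_mk`,
`exists_pow_smul_eq_zero_of_resOf_eq_zero`, `pow_smul_injective`, `tupleProd_cons`,
`cons_comp_succAbove_succ`). Everything is proved; no named facts.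

## References

* [Eisenbud2005] D. Eisenbud, *The Geometry of Syzygies*, GTM 229, Appendix 1, Prop. A1.1,
  Cor. A1.2, Thm. A1.3.
* [Grothendieck1968SGA2] A. Grothendieck, SGA 2, Exp. II, arXiv:math/0511279.
-/

noncomputable section

open CategoryTheory AlgebraicTopology

universe u

namespace Literature.RingTheory.LocalCohomology

variable {R : Type u} [CommRing R] {s : ℕ} (y : Fin s → R) (M : Type u) [AddCommGroup M]
  [Module R M]

/-! ## Formulas in the localisations -/

section LocFormulas

variable {y M}

/-- Every element of `M_{y_t}` becomes an element of `M` after multiplication by a power of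
`y_t`. [folklore] -/
theorem exists_pow_smul_eq_mk {n : ℕ} (t : Fin n → Fin s) (z : CechLoc y M t) :
    ∃ (N : ℕ) (m : M), tupleProd y t ^ N • z = LocalizedModule.mk m 1 := by
  induction z using LocalizedModule.induction_on with
  | h m k =>
    obtain ⟨k, N, rfl⟩ := k
    refine ⟨N, m, ?_⟩
    rw [LocalizedModule.smul'_mk]
    have := LocalizedModule.mk_cancel_common_left
      (⟨_, N, rfl⟩ : Submonoid.powers (tupleProd y t)) 1 m
    rw [mul_one] at this
    exact this

/-- The same with any larger exponent. [folklore] -/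
theorem exists_pow_smul_eq_mk_of_le {n : ℕ} (t : Fin n → Fin s) (z : CechLoc y M t) :
    ∃ N₀ : ℕ, ∀ N, N₀ ≤ N → ∃ m : M, tupleProd y t ^ N • z = LocalizedModule.mk m 1 := by
  obtain ⟨N₀, m, hm⟩ := exists_pow_smul_eq_mk t z
  refine ⟨N₀, fun N hN => ⟨tupleProd y t ^ (N - N₀) • m, ?_⟩⟩
  conv_lhs => rw [← Nat.sub_add_cancel hN, pow_add, mul_smul, hm, LocalizedModule.smul'_mk]

/-- `y_t ^ N` acts bijectively on `M_{y_t}`: every element is divisible by `y_t ^ N`.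
[folklore] -/
theorem exists_pow_smul_eq {n : ℕ} (t : Fin n → Fin s) (N : ℕ) (z : CechLoc y M t) :
    ∃ x : CechLoc y M t, tupleProd y t ^ N • x = z := by
  have h := IsLocalizedModule.map_units (LocalizedModule.mkLinearMap
    (Submonoid.powers (tupleProd y t)) M) (⟨tupleProd y t ^ N, N, rfl⟩ : Submonoid.powers _)
  obtain ⟨x, hx⟩ := ((Module.End.isUnit_iff _).mp h).2 z
  exact ⟨x, hx⟩

/-- `y_u ^ N` acts injectively on `M_{y_t}` when `y_u` divides a power of `y_t`. [folklore] -/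
theorem pow_smul_injective {n n' : ℕ} {u : Fin n' → Fin s} {t : Fin n → Fin s}
    (h : ∃ K, tupleProd y u ∣ tupleProd y t ^ K) (N : ℕ) :
    Function.Injective fun x : CechLoc y M t => tupleProd y u ^ N • x := by
  have hu := isUnit_algebraMap_end_cechLoc_of_dvd (M := M) h ⟨tupleProd y u ^ N, N, rfl⟩
  exact ((Module.End.isUnit_iff _).mp hu).1

/-- The kernel of `M_{y_u} → M_{y_t}` is killed by powers of `y_t`. [folklore] -/
theorem exists_pow_smul_eq_zero_of_resOf_eq_zero {n n' : ℕ} (u : Fin n' → Fin s)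
    (t : Fin n → Fin s) (h : ∃ K, tupleProd y u ∣ tupleProd y t ^ K) (x : CechLoc y M u)
    (hx : resOf y M u t h x = 0) : ∃ K : ℕ, tupleProd y t ^ K • x = 0 := by
  induction x using LocalizedModule.induction_on with
  | h m k =>
    rw [resOf, LocalizedModule.lift_mk] at hx
    have h1 : LocalizedModule.mkLinearMap (Submonoid.powers (tupleProd y t)) M m = 0 := by
      have := congrArg ((isUnit_algebraMap_end_cechLoc_of_dvd (M := M) h k).unit.val) hx
      rwa [map_zero, ← Module.End.mul_apply, Units.mul_inv, Module.End.one_apply] at this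
    obtain ⟨⟨_, K, rfl⟩, hK⟩ := (IsLocalizedModule.eq_zero_iff (Submonoid.powers (tupleProd y t))
      (LocalizedModule.mkLinearMap (Submonoid.powers (tupleProd y t)) M)).mp h1
    refine ⟨K, ?_⟩
    rw [LocalizedModule.smul'_mk]
    change LocalizedModule.mk ((⟨_, K, rfl⟩ : Submonoid.powers (tupleProd y t)) • m) k = 0
    rw [hK, LocalizedModule.zero_mk]

/-- Transport of `resOf` along an equality of source tuples. [folklore] -/
theorem resOf_apply_congr {n m : ℕ} (c : CechObj y M m) {u u' : Fin (m + 1) → Fin s}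
    (e : u = u') (t : Fin n → Fin s) (h : ∃ K, tupleProd y u ∣ tupleProd y t ^ K)
    (h' : ∃ K, tupleProd y u' ∣ tupleProd y t ^ K) :
    resOf y M u t h (c u) = resOf y M u' t h' (c u') := by
  subst e
  rfl

/-- `y_{(j, t)} = y_j · y_t`. [folklore] -/
theorem tupleProd_cons {n : ℕ} (j : Fin s) (t : Fin n → Fin s) :
    tupleProd y (Fin.cons j t : Fin (n + 1) → Fin s) = y j * tupleProd y t := by
  simp [tupleProd, Fin.prod_univ_succ]

/-- `(j, t) ∘ δ_{k+1} = (j, t ∘ δ_k)`. [folklore] -/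
theorem cons_comp_succAbove_succ {n : ℕ} (j : Fin s) (t : Fin (n + 1) → Fin s) (k : Fin (n + 1)) :
    (Fin.cons j t : Fin (n + 2) → Fin s) ∘ Fin.succAbove k.succ = Fin.cons j (t ∘ Fin.succAbove k) := by
  funext i
  refine Fin.cases ?_ (fun i => ?_) i
  · simp
  · simp [Fin.succ_succAbove_succ]

/-- `(j, t) ∘ δ_0 = t`. [folklore] -/
theorem cons_comp_succAbove_zero {n : ℕ} (j : Fin s) (t : Fin (n + 1) → Fin s) :
    (Fin.cons j t : Fin (n + 2) → Fin s) ∘ Fin.succAbove 0 = t := by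
  funext i
  simp

end LocFormulas

/-! ## The Čech cohomology classes are `y_j`-power torsion -/

section Torsion

variable {y M}

/-- **Degree 0**: an element of `M` dying in every `M_{y_i}` is killed by a power of each `y_j`.
[folklore] -/
theorem exists_pow_smul_eq_zero_of_cechAug_eq_zero (m : M) (hm : cechAug y M m = 0) (j : Fin s) :
    ∃ N : ℕ, y j ^ N • m = 0 := by
  have h1 : LocalizedModule.mkLinearMap (Submonoid.powers (tupleProd y ![j])) M m = 0 := by
    have := congrFun hm ![j]
    simpa using this
  obtain ⟨⟨_, K, rfl⟩, hK⟩ := (IsLocalizedModule.eq_zero_iff (Submonoid.powers (tupleProd y ![j]))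
    (LocalizedModule.mkLinearMap (Submonoid.powers (tupleProd y ![j])) M)).mp h1
  refine ⟨K, ?_⟩
  have : tupleProd y ![j] = y j := by simp [tupleProd]
  rw [← this]
  exact hK


/-- If every component `e(T)` of a cochain dies in `M_{y_{(j,T)}}`, then a power of `y_j` kills
`e`. [folklore] -/
theorem exists_pow_smul_eq_zero_of_res_cons_eq_zero {n : ℕ} (e : CechObj y M n) (j : Fin s)
    (key : ∀ T : Fin (n + 1) → Fin s, res y M (Fin.cons j T) Fin.succ (e T) = 0) :
    ∃ K : ℕ, y j ^ K • e = 0 := by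
  have hT : ∀ T : Fin (n + 1) → Fin s, ∃ K : ℕ, y j ^ K • e T = 0 := by
    intro T
    obtain ⟨K, hK⟩ := exists_pow_smul_eq_zero_of_resOf_eq_zero
      ((Fin.cons j T : Fin (n + 2) → Fin s) ∘ Fin.succ) (Fin.cons j T) (dvd_comp y _ Fin.succ)
      (e T) (key T)
    refine ⟨K, ?_⟩
    apply pow_smul_injective (M := M) (u := T) (t := T) ⟨1, by simp⟩ K
    dsimp only
    rw [smul_zero, ← mul_smul, ← mul_pow, mul_comm]
    rw [tupleProd_cons] at hK
    exact hK
  choose K hK using hT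
  refine ⟨Finset.univ.sup K, ?_⟩
  funext T
  rw [Pi.smul_apply, Pi.zero_apply]
  have hle : K T ≤ Finset.univ.sup K := Finset.le_sup (Finset.mem_univ T)
  rw [← Nat.sub_add_cancel hle, pow_add, mul_smul, hK T, smul_zero]

/-- **Construction of the primitive** (degree `≥ 1`): for a cochain `c ∈ Č^{q+1}` and an index
`j` there are `N` and `b ∈ Č^q` with `b(t')|_{(j,t')} = y_j^N c(j, t')` for all `t'`. [folklore] -/
theorem exists_res_eq_pow_smul (q : ℕ) (c : CechObj y M (q + 1)) (j : Fin s) :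
    ∃ (N : ℕ) (b : CechObj y M q), ∀ t' : Fin (q + 1) → Fin s,
      res y M (Fin.cons j t') Fin.succ (b t') = y j ^ N • c (Fin.cons j t') := by
  have hex := fun t' : Fin (q + 1) → Fin s =>
    exists_pow_smul_eq_mk_of_le (Fin.cons j t' : Fin (q + 2) → Fin s) (c (Fin.cons j t'))
  choose N₀ hN₀ using hex
  set N := Finset.univ.sup N₀ with hN
  have hle : ∀ t', N₀ t' ≤ N := fun t' => Finset.le_sup (Finset.mem_univ t')
  have hm := fun t' => hN₀ t' N (hle t')
  choose m hm using hm
  have hb := fun t' : Fin (q + 1) → Fin s =>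
    exists_pow_smul_eq t' N (LocalizedModule.mk (m t') 1 : CechLoc y M t')
  choose b hb using hb
  refine ⟨N, b, fun t' => ?_⟩
  apply pow_smul_injective (M := M) (u := t') (t := (Fin.cons j t' : Fin (q + 2) → Fin s))
    (dvd_comp y (Fin.cons j t') Fin.succ) N
  dsimp only
  rw [← LinearMap.map_smul]
  erw [hb, res_mk_one, ← hm]
  rw [show tupleProd y (Fin.cons j t' : Fin (q + 2) → Fin s) ^ N = tupleProd y t' ^ N * y j ^ N by
    rw [tupleProd_cons, mul_pow, mul_comm], mul_smul]

/-- **The Čech cohomology classes are `y_j`-power torsion** (degrees `≥ 1`): if `c ∈ Č^{q+1}` is a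
cocycle then `y_j^N c` is a coboundary for some `N`. (Contracting the complex towards the index
`j`.) [folklore] -/
theorem exists_pow_smul_eq_dC (q : ℕ) (c : CechObj y M (q + 1)) (hc : dC (q + 1) c = 0)
    (j : Fin s) : ∃ (N : ℕ) (b : CechObj y M q), y j ^ N • c = dC q b := by
  obtain ⟨N, b, hb⟩ := exists_res_eq_pow_smul q c j
  -- the key identity: `(y_j^N c - d b)(T)` dies in `M_{y_{(j,T)}}`
  have key : ∀ T : Fin (q + 2) → Fin s,
      res y M (Fin.cons j T) Fin.succ ((y j ^ N • c - dC q b) T) = 0 := by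
    intro T
    set jT : Fin (q + 3) → Fin s := Fin.cons j T with hjT
    -- the terms
    set B : Fin (q + 2) → CechLoc y M jT := fun k =>
      res y M jT (Fin.succAbove k.succ) (c (jT ∘ Fin.succAbove k.succ)) with hB
    set D : Fin (q + 2) → CechLoc y M jT := fun k =>
      res y M jT (Fin.succ ∘ Fin.succAbove k) (b (T ∘ Fin.succAbove k)) with hD
    -- (1) the cocycle condition at `(j, T)`: `c(T)| = Σ_k (-1)^k B_k`
    have hcT := congrFun hc jT
    rw [dC_apply, Pi.zero_apply, Fin.sum_univ_succ] at hcT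
    have e0 : res y M jT (Fin.succAbove 0) (c (jT ∘ Fin.succAbove 0)) =
        res y M jT Fin.succ (c T) :=
      resOf_apply_congr c (by rw [hjT, Fin.succAbove_zero]) jT _ _
    rw [e0] at hcT
    simp only [Fin.val_zero, pow_zero, one_smul] at hcT
    have hA : res y M jT Fin.succ (c T) = ∑ k : Fin (q + 2), (-1 : ℤ) ^ (k : ℕ) • B k := by
      rw [add_eq_zero_iff_eq_neg, ← Finset.sum_neg_distrib] at hcT
      rw [hcT]
      refine Finset.sum_congr rfl fun k _ => ?_
      rw [Fin.val_succ, pow_succ, mul_neg_one, neg_smul, neg_neg]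
    -- (2) `y_j^N • B_k = D_k`
    have hBD : ∀ k : Fin (q + 2), y j ^ N • B k = D k := by
      intro k
      have ek : B k = resOf y M (Fin.cons j (T ∘ Fin.succAbove k)) jT
          (by rw [← cons_comp_succAbove_succ]; exact dvd_comp y jT _)
          (c (Fin.cons j (T ∘ Fin.succAbove k))) :=
        resOf_apply_congr c (cons_comp_succAbove_succ j T k) jT _ _
      rw [ek, ← LinearMap.map_smul, ← hb (T ∘ Fin.succAbove k), hD]
      dsimp only
      rw [res_eq_resOf, res_eq_resOf, ← LinearMap.comp_apply]
      erw [resOf_comp y M _ _ _ _ _ (dvd_comp y jT (Fin.succ ∘ Fin.succAbove k))]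
      rfl
    -- (3) conclude: both `y_j^N c(T)|` and `(d b)(T)|` equal `Σ_k (-1)^k D_k`
    erw [map_sub, LinearMap.map_smul, sub_eq_zero, hA, Finset.smul_sum, dC_apply, map_sum]
    refine Finset.sum_congr rfl fun k _ => ?_
    rw [smul_comm, hBD k]
    erw [map_zsmul]
    congr 1
    have := congrArg (fun f => f (b (T ∘ Fin.succAbove k))) (res_comp y M jT Fin.succ (Fin.succAbove k))
    exact this.symm
  -- from `key`, a power of `y_j` kills `y_j^N c - d b`
  obtain ⟨K, hK⟩ := exists_pow_smul_eq_zero_of_res_cons_eq_zero (y j ^ N • c - dC q b) j key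
  refine ⟨K + N, y j ^ K • b, ?_⟩
  rw [LinearMap.map_smul, pow_add, mul_smul]
  rw [smul_sub, sub_eq_zero] at hK
  exact hK

/-- **The Čech cohomology classes are `y_j`-power torsion** (degree `0`): if `c ∈ Č^0` is a cocycle
then `y_j^N c` is in the image of the augmentation `M → Č^0` for some `N`. [folklore] -/
theorem exists_pow_smul_eq_cechAug (c : CechObj y M 0) (hc : dC 0 c = 0) (j : Fin s) :
    ∃ (N : ℕ) (m : M), y j ^ N • c = cechAug y M m := by
  set t0 : Fin 1 → Fin s := Fin.cons j Fin.elim0 with ht0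
  obtain ⟨N, m, hm⟩ := exists_pow_smul_eq_mk t0 (c t0)
  have ht0p : tupleProd y t0 ^ N = y j ^ N := by simp [tupleProd, ht0]
  have key : ∀ T : Fin 1 → Fin s,
      res y M (Fin.cons j T) Fin.succ ((y j ^ N • c - cechAug y M m) T) = 0 := by
    intro T
    set jT : Fin 2 → Fin s := Fin.cons j T with hjT
    have hcT := congrFun hc jT
    rw [dC_apply, Pi.zero_apply, Fin.sum_univ_two] at hcT
    have e0 : res y M jT (Fin.succAbove 0) (c (jT ∘ Fin.succAbove 0)) =
        res y M jT Fin.succ (c T) :=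
      resOf_apply_congr c (by rw [hjT, Fin.succAbove_zero]) jT _ _
    have E : jT ∘ Fin.succAbove 1 = t0 := by
      funext i
      refine Fin.cases ?_ (fun i => i.elim0) i
      simp [hjT, ht0]
    have h1 : ∃ K, tupleProd y t0 ∣ tupleProd y jT ^ K := E ▸ dvd_comp y jT (Fin.succAbove 1)
    have e1 : res y M jT (Fin.succAbove 1) (c (jT ∘ Fin.succAbove 1)) = resOf y M t0 jT h1 (c t0) :=
      resOf_apply_congr c E jT _ _
    rw [e0, e1] at hcT
    simp only [Fin.val_zero, pow_zero, one_smul, Fin.val_one, pow_one, neg_smul,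
      ← sub_eq_add_neg, sub_eq_zero] at hcT
    -- hcT : res jT succ (c T) = resOf t0 jT h1 (c t0)
    erw [map_sub, LinearMap.map_smul, sub_eq_zero, hcT, ← LinearMap.map_smul, ← ht0p, hm,
      resOf_mk_one]
  obtain ⟨K, hK⟩ := exists_pow_smul_eq_zero_of_res_cons_eq_zero (y j ^ N • c - cechAug y M m) j key
  refine ⟨K + N, y j ^ K • m, ?_⟩
  rw [LinearMap.map_smul, pow_add, mul_smul]
  rw [smul_sub, sub_eq_zero] at hK
  exact hK

end Torsion

end Literature.RingTheory.LocalCohomology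

end
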